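import Summits.BirchSwinnertonDyer.Rank1Residual.Additive.KobayashiLogFss
import Literature.NumberTheory.EllipticCurves.FormalGroupMultiplication
import HarnessLib

/-!
# Sprung's supersingular logarithm of Honda type `p − a T + T²`:
# `log_{F_ss}(X) = ∑ₖ xₖ ((1+X)^{pᵏ} − 1)`, `p x_{k+2} = a x_{k+1} − x_k`, `x₀ = 1`, `p x₁ = a`
# (route `PrintX8VS` / `PrintX8`, support item `InputHondaSystem` = stmt-BirchSwinnertonDyer-20413, the tree's named fact
# `Literature.NumberTheory.EllipticCurves.Sprung2012.thm22_exists_isHondaSystem`; file 1 of the local series: the logarithm)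

HONEST FRAMING (desk `pub/bsd-wall/bsd-inputs`, seat `bsd-inputs-honda-p1`, D-0154 (2) INPUTS): THEOREMS ONLY — no definition, no
named fact, no instance, no `sorry`; pure `p`-adic power-series algebra; closes nothing by itself; BSD is not proved by any of this.
Proving the input `thm22_exists_isHondaSystem` makes the `PrintX8VS` line unconditional AS TYPED only.

## What

F. Sprung, *J. Number Theory* **132** (2012), proof of Thm. 2.2 (p. 1487): "What we need is a formal group whose logarithm is of
Honda type `t² − a_p t + p`. We thus look at the sequence `{x_k}` given by `(x_k, x_{k−1}) := (1, 0) Aᵏ × p^{−k}` for `k ⩾ 0`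
[`A = (a_p, p; −1, 0)`, Def. 2.1]. The logarithm giving rise to our formal group via Honda theory [Kobayashi, Theorem 8.3 iii)]
is then the power series `log_{F_ss}(X) = ∑_{k=0}^∞ x_k ((1 + X)^{pᵏ} − 1)`." For `a_p = 0` this is Kobayashi's
`∑ₖ (−1)ᵏ((1+X)^{p^{2k}} − 1)/pᵏ` (Invent. Math. 152 (2003) §8.2), the tree's `HondaFss.logFss` (file
`Rank1Residual/Additive/KobayashiLogFss`, whose architecture this file follows for general `a`).

To stay DEFINITION-FREE the sequence `x` is carried as data with its three defining properties
`x 0 = 1`, `p · x 1 = a`, `p · x (k+2) = a · x (k+1) − x k` (so `x₁ = a/p`, `x₂ = (a² − p)/p²`, …), and the logarithm is the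
explicit power series `PowerSeries.mk fun d ↦ ∑' k, x k * (C(pᵏ, d) − [d = 0])` (the `Xᵈ`-coefficient of
`x_k((1+X)^{pᵏ} − 1)` is `x_k (C(pᵏ, d) − [d = 0])`; the sum over `k` converges `p`-adically).

* §1 **growth** `‖x k‖ ≤ (√p)ᵏ` when `‖a‖ ≤ p⁻¹` (supersingular: `p ∣ a_p`), so `‖x_k C(pᵏ, d)‖ ≤ d (1/√p)ᵏ` and the coefficient
  sums converge; for `‖a‖ = 1` (ordinary) they diverge, as they must.
* §2 the logarithm: `log(0) = 0`, `‖[Xᵈ] log‖ ≤ d`, `‖[X¹] log‖ = 1`.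
* §3 **`norm_coeff_hondaShift_sprungLog_le_one`: `log_{F_ss}` is of Honda type `p − aT + T²`**, i.e.
  `hondaShift p a log = log − (a/p) log(Xᵖ) + (1/p) log(X^{p²}) ∈ ℤ_p⟦X⟧` (Kobayashi Thm. 8.3 iii) / Sprung p. 1487): the
  `k`-th combined coefficient `x_{k+2}C(p^{k+2},n) − (a/p)x_{k+1}C(p^{k+1},n/p) + (1/p)x_kC(pᵏ,n/p²)` equals, by the recursion,
  `(a/p)x_{k+1}[Xⁿ]((1+X)^{p^{k+2}} − (1+Xᵖ)^{p^{k+1}}) − (1/p)x_k[Xⁿ]((1+X)^{p^{k+2}} − (1+X^{p²})^{pᵏ})`, and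
  `(1+X)^{p^{k+2}} ≡ (1+Xᵖ)^{p^{k+1}} (mod p^{k+2})`, `≡ (1+X^{p²})^{pᵏ} (mod p^{k+1})` (the tree's
  `norm_coeff_pow_prime_pow_sub_le`, `norm_coeff_pow_(sq_)sub_expand_le`).

References: [Sprung2012] F. Sprung, J. Number Theory 132 (2012), Def. 2.1, Thm. 2.2 and its proof (p. 1487);
[Kobayashi2003] S. Kobayashi, Invent. Math. 152 (2003), Def. 8.2, Thm. 8.3, §8.2; [Honda1970] T. Honda, J. Math. Soc. Japan 22
(1970), §2, Thm. 2; M. Hazewinkel, *Formal Groups and Applications* (1978), I.2.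
-/

set_option autoImplicit false
-- the Theorems namespace of this sub repeats the summit name by design (D-0017 nested layout)
set_option linter.dupNamespace false

noncomputable section
open scoped Classical Topology
open Filter PowerSeries
namespace Summit.BirchSwinnertonDyer.BirchSwinnertonDyer.Theorems
namespace SprungHonda
open Literature.RingTheory.FormalGroups Summit.BirchSwinnertonDyer.Rank1Residual.Additive.HondaFss
variable {p : ℕ} [hp : Fact p.Prime]

/-! ## §1 The Sprung sequence `x_k`: growth `‖x_k‖ ≤ (√p)ᵏ` -/

/-- `1 ≤ √p` and `√p · √p = p`. [folklore] -/
theorem one_le_sqrt_p : (1 : ℝ) ≤ Real.sqrt p ∧ Real.sqrt p * Real.sqrt p = p := by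
  have hp1 : (1 : ℝ) ≤ p := by exact_mod_cast hp.out.one_lt.le
  exact ⟨by simpa using Real.sqrt_le_sqrt hp1, Real.mul_self_sqrt (by positivity)⟩

/-- **Growth of the Sprung sequence**: if `x 0 = 1`, `p x 1 = a`, `p x (k+2) = a x (k+1) − x k` and `‖a‖ ≤ p⁻¹`
(supersingular), then `‖x k‖ ≤ (√p)ᵏ` (two-step induction: `‖x_{k+2}‖ ≤ p · max(‖a‖‖x_{k+1}‖, ‖x_k‖)`).
[cite: Sprung2012, Def. 2.1 and proof of Thm. 2.2 (p. 1487)] -/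
theorem norm_sprungSeq_le {a : ℚ_[p]} (ha : ‖a‖ ≤ (p : ℝ)⁻¹) {x : ℕ → ℚ_[p]} (hx0 : x 0 = 1)
    (hx1 : (p : ℚ_[p]) * x 1 = a) (hrec : ∀ k, (p : ℚ_[p]) * x (k + 2) = a * x (k + 1) - x k) (k : ℕ) :
    ‖x k‖ ≤ Real.sqrt p ^ k := by
  obtain ⟨hs1, hss⟩ := one_le_sqrt_p (p := p)
  have hp0 : (0 : ℝ) < p := by exact_mod_cast hp.out.pos
  have hpQ : (p : ℚ_[p]) ≠ 0 := Nat.cast_ne_zero.mpr hp.out.ne_zero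
  have hnp : ‖(p : ℚ_[p])‖ = (p : ℝ)⁻¹ := Padic.norm_p
  suffices H : ∀ k, ‖x k‖ ≤ Real.sqrt p ^ k ∧ ‖x (k + 1)‖ ≤ Real.sqrt p ^ (k + 1) from (H k).1
  intro k
  induction k with
  | zero =>
    refine ⟨by simp [hx0], ?_⟩
    have e : x 1 = a / p := (eq_div_iff hpQ).mpr (by rw [mul_comm]; exact hx1)
    rw [e, norm_div, hnp, zero_add, pow_one]
    calc ‖a‖ / (p : ℝ)⁻¹ ≤ (p : ℝ)⁻¹ / (p : ℝ)⁻¹ := div_le_div_of_nonneg_right ha (by positivity)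
      _ = 1 := div_self (by positivity)
      _ ≤ Real.sqrt p := hs1
  | succ k ih =>
    refine ⟨ih.2, ?_⟩
    have e : x (k + 2) = (a * x (k + 1) - x k) / p := (eq_div_iff hpQ).mpr (by rw [mul_comm]; exact hrec k)
    rw [show k + 1 + 1 = k + 2 from rfl, e, norm_div, hnp, div_eq_mul_inv, inv_inv]
    have hmax : ‖a * x (k + 1) - x k‖ ≤ max (‖a‖ * ‖x (k + 1)‖) ‖x k‖ := by
      rw [← norm_mul]; exact Literature.NumberTheory.EllipticCurves.padic_norm_sub_le_max _ _
    have h1 : ‖a‖ * ‖x (k + 1)‖ * p ≤ Real.sqrt p ^ (k + 2) := by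
      calc ‖a‖ * ‖x (k + 1)‖ * p ≤ (p : ℝ)⁻¹ * Real.sqrt p ^ (k + 1) * p := by gcongr; exact ih.2
        _ = Real.sqrt p ^ (k + 1) := by field_simp
        _ ≤ Real.sqrt p ^ (k + 2) := pow_le_pow_right₀ hs1 (by omega)
    have h2 : ‖x k‖ * p ≤ Real.sqrt p ^ (k + 2) := by
      calc ‖x k‖ * p ≤ Real.sqrt p ^ k * p := by gcongr; exact ih.1
        _ = Real.sqrt p ^ (k + 2) := by rw [pow_add, sq, hss]
    calc ‖a * x (k + 1) - x k‖ * p ≤ max (‖a‖ * ‖x (k + 1)‖) ‖x k‖ * p := by gcongr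
      _ = max (‖a‖ * ‖x (k + 1)‖ * p) (‖x k‖ * p) := max_mul_of_nonneg _ _ hp0.le
      _ ≤ Real.sqrt p ^ (k + 2) := max_le h1 h2

/-- `(√p)ᵏ · p⁻ᵏ = ((√p)⁻¹)ᵏ`. [folklore] -/
theorem sqrt_pow_mul_inv_pow (k : ℕ) : Real.sqrt p ^ k * ((p : ℝ)⁻¹) ^ k = ((Real.sqrt p)⁻¹) ^ k := by
  obtain ⟨hs1, hss⟩ := one_le_sqrt_p (p := p)
  rw [← mul_pow]
  congr 1
  have hs0 : Real.sqrt p ≠ 0 := by positivity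
  have h : (p : ℝ)⁻¹ = (Real.sqrt p)⁻¹ * (Real.sqrt p)⁻¹ := by rw [← mul_inv, hss]
  rw [h, ← mul_assoc, mul_inv_cancel₀ hs0, one_mul]

/-- `(√p)⁻¹ < 1` and `0 ≤ (√p)⁻¹`. [folklore] -/
theorem sqrt_inv_lt_one : ((Real.sqrt p)⁻¹ : ℝ) < 1 ∧ (0 : ℝ) ≤ (Real.sqrt p)⁻¹ := by
  have hp1 : (1 : ℝ) < p := by exact_mod_cast hp.out.one_lt
  have h1 : (1 : ℝ) < Real.sqrt p := by simpa using Real.sqrt_lt_sqrt zero_le_one hp1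
  exact ⟨inv_lt_one_of_one_lt₀ h1, by positivity⟩

/-! ## §2 Binomial congruences -/

/-- The binomial difference `(C(p^{j+1}, n) − [n=0]) − [p ∣ n](C(pʲ, n/p) − [n/p = 0])` is the `Xⁿ`-coefficient of
`(1+X)^{p^{j+1}} − (1+Xᵖ)^{pʲ}`. [folklore] -/
theorem choose_sub_choose_div_eq_coeff (j n : ℕ) :
    ((((p ^ (j + 1)).choose n : ℚ_[p]) - if n = 0 then 1 else 0) -
        if p ∣ n then (((p ^ j).choose (n / p) : ℚ_[p]) - if n / p = 0 then 1 else 0) else 0) =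
      coeff n ((1 + X : ℚ_[p]⟦X⟧) ^ p ^ (j + 1) - expand p (prime_ne_zero p) ((1 + X : ℚ_[p]⟦X⟧) ^ p ^ j)) := by
  have e : (1 + X : ℚ_[p]⟦X⟧) ^ p ^ (j + 1) - expand p (prime_ne_zero p) ((1 + X : ℚ_[p]⟦X⟧) ^ p ^ j) =
      ((1 + X : ℚ_[p]⟦X⟧) ^ p ^ (j + 1) - 1) - expand p (prime_ne_zero p) ((1 + X : ℚ_[p]⟦X⟧) ^ p ^ j - 1) := by
    rw [map_sub, map_one]; ring
  rw [e, map_sub, coeff_expand]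
  simp only [map_sub, coeff_one_add_X_pow, coeff_one]

/-- The binomial difference `(C(p^{k+2}, n) − [n=0]) − [p² ∣ n](C(pᵏ, n/p²) − [n/p² = 0])` is the `Xⁿ`-coefficient of
`(1+X)^{p^{k+2}} − (1+X^{p²})^{pᵏ}`. [folklore] -/
theorem choose_sub_choose_div_sq_eq_coeff (k n : ℕ) :
    ((((p ^ (k + 2)).choose n : ℚ_[p]) - if n = 0 then 1 else 0) -
        if p ^ 2 ∣ n then (((p ^ k).choose (n / p ^ 2) : ℚ_[p]) - if n / p ^ 2 = 0 then 1 else 0) else 0) =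
      coeff n ((1 + X : ℚ_[p]⟦X⟧) ^ p ^ (k + 2) -
        expand (p ^ 2) (prime_sq_ne_zero p) ((1 + X : ℚ_[p]⟦X⟧) ^ p ^ k)) := by
  have e : (1 + X : ℚ_[p]⟦X⟧) ^ p ^ (k + 2) - expand (p ^ 2) (prime_sq_ne_zero p) ((1 + X : ℚ_[p]⟦X⟧) ^ p ^ k) =
      ((1 + X : ℚ_[p]⟦X⟧) ^ p ^ (k + 2) - 1) -
        expand (p ^ 2) (prime_sq_ne_zero p) ((1 + X : ℚ_[p]⟦X⟧) ^ p ^ k - 1) := by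
    rw [map_sub, map_one]; ring
  rw [e, map_sub, coeff_expand]
  simp only [map_sub, coeff_one_add_X_pow, coeff_one]

/-- `(1+X)^{p^{j+1}} ≡ (1+Xᵖ)^{pʲ} (mod p^{j+1})`, coefficientwise (Hazewinkel 1978, I.2.3). [folklore] -/
theorem norm_coeff_pow_sub_expand_p_pow_le (j n : ℕ) :
    ‖coeff n ((1 + X : ℚ_[p]⟦X⟧) ^ p ^ (j + 1) - expand p (prime_ne_zero p) ((1 + X : ℚ_[p]⟦X⟧) ^ p ^ j))‖ ≤
      (p : ℝ)⁻¹ ^ (j + 1) := by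
  have hXc : ∀ m, ‖coeff m (X : ℚ_[p]⟦X⟧)‖ ≤ 1 := fun m ↦ by
    rw [coeff_X]; split_ifs <;> simp
  have h1X : ∀ m, ‖coeff m (1 + X : ℚ_[p]⟦X⟧)‖ ≤ 1 := norm_coeff_add_le norm_coeff_one_le hXc
  have hαβ := norm_coeff_pow_sub_expand_le h1X
  have hβ : ∀ m, ‖coeff m (expand p (prime_ne_zero p) (1 + X : ℚ_[p]⟦X⟧))‖ ≤ 1 :=
    norm_coeff_expand_le _ zero_le_one h1X
  have h := norm_coeff_pow_prime_pow_sub_le (s := 1) le_rfl hβ (fun m ↦ by simpa using hαβ m) j n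
  have e1 : ((1 + X : ℚ_[p]⟦X⟧) ^ p) ^ p ^ j = (1 + X : ℚ_[p]⟦X⟧) ^ p ^ (j + 1) := by
    rw [← pow_mul, ← pow_succ']
  have e2 : (expand p (prime_ne_zero p) (1 + X : ℚ_[p]⟦X⟧)) ^ p ^ j =
      expand p (prime_ne_zero p) ((1 + X : ℚ_[p]⟦X⟧) ^ p ^ j) := by rw [map_pow]
  rw [e1, e2, Nat.add_comm 1 j] at h
  exact h

/-- `(1+X)^{p^{k+2}} ≡ (1+X^{p²})^{pᵏ} (mod p^{k+1})`, coefficientwise (Hazewinkel 1978, I.2.3). [folklore] -/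
theorem norm_coeff_pow_sub_expand_sq_pow_le (k n : ℕ) :
    ‖coeff n ((1 + X : ℚ_[p]⟦X⟧) ^ p ^ (k + 2) - expand (p ^ 2) (prime_sq_ne_zero p) ((1 + X : ℚ_[p]⟦X⟧) ^ p ^ k))‖ ≤
      (p : ℝ)⁻¹ ^ (k + 1) := by
  have hXc : ∀ m, ‖coeff m (X : ℚ_[p]⟦X⟧)‖ ≤ 1 := fun m ↦ by
    rw [coeff_X]; split_ifs <;> simp
  have h1X : ∀ m, ‖coeff m (1 + X : ℚ_[p]⟦X⟧)‖ ≤ 1 := norm_coeff_add_le norm_coeff_one_le hXc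
  have hαβ := norm_coeff_pow_sq_sub_expand_le h1X
  have hβ : ∀ m, ‖coeff m (expand (p ^ 2) (prime_sq_ne_zero p) (1 + X : ℚ_[p]⟦X⟧))‖ ≤ 1 :=
    norm_coeff_expand_le _ zero_le_one h1X
  have h := norm_coeff_pow_prime_pow_sub_le (s := 1) le_rfl hβ (fun m ↦ by simpa using hαβ m) k n
  have e1 : ((1 + X : ℚ_[p]⟦X⟧) ^ p ^ 2) ^ p ^ k = (1 + X : ℚ_[p]⟦X⟧) ^ p ^ (k + 2) := by
    rw [← pow_mul, ← pow_add, Nat.add_comm 2 k]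
  have e2 : (expand (p ^ 2) (prime_sq_ne_zero p) (1 + X : ℚ_[p]⟦X⟧)) ^ p ^ k =
      expand (p ^ 2) (prime_sq_ne_zero p) ((1 + X : ℚ_[p]⟦X⟧) ^ p ^ k) := by rw [map_pow]
  rw [e1, e2, Nat.add_comm 1 k] at h
  exact h

/-! ## §3 The logarithm and its Honda type `p − aT + T²` -/

/-- Abstract form of the type computation: for a summable double family `t k d` whose head terms `t 0 n`,
`t 1 n − c₂[P₂] t 0 d₂` and combined terms `t (k+2) n − c₂[P₂] t (k+1) d₂ + c₃[P₃] t k d₃` are all integral, the combination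
`∑ₖ t k n − c₂[P₂]∑ₖ t k d₂ + c₃[P₃]∑ₖ t k d₃` is integral (regrouping of three convergent `p`-adic sums; ultrametric inequality).
[folklore] -/
theorem norm_three_tsum_comb_le_one {t : ℕ → ℕ → ℚ_[p]} (hs : ∀ d, Summable fun k ↦ t k d) (c₂ c₃ : ℚ_[p])
    (n d₂ d₃ : ℕ) {P₂ P₃ : Prop} {i₂ : Decidable P₂} {i₃ : Decidable P₃}
    (h0 : ‖t 0 n‖ ≤ 1) (h1 : ‖t 1 n - c₂ * (if P₂ then t 0 d₂ else 0)‖ ≤ 1)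
    (hk : ∀ k, ‖t (k + 2) n - c₂ * (if P₂ then t (k + 1) d₂ else 0) + c₃ * (if P₃ then t k d₃ else 0)‖ ≤ 1) :
    ‖∑' k, t k n - c₂ * (if P₂ then ∑' k, t k d₂ else 0) + c₃ * (if P₃ then ∑' k, t k d₃ else 0)‖ ≤ 1 := by
  set u : ℕ → ℚ_[p] := fun k ↦ c₂ * (if P₂ then t k d₂ else 0) with hu
  set v : ℕ → ℚ_[p] := fun k ↦ c₃ * (if P₃ then t k d₃ else 0) with hv
  have hsu : Summable u := by
    by_cases hP : P₂
    · simp only [hu, if_pos hP]; exact (hs d₂).mul_left _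
    · simp only [hu, if_neg hP, mul_zero]; exact summable_zero
  have hsv : Summable v := by
    by_cases hP : P₃
    · simp only [hv, if_pos hP]; exact (hs d₃).mul_left _
    · simp only [hv, if_neg hP, mul_zero]; exact summable_zero
  have h2 : c₂ * (if P₂ then ∑' k, t k d₂ else 0) = ∑' k, u k := by
    by_cases hP : P₂
    · simp only [hu, if_pos hP]; rw [tsum_mul_left]
    · simp only [hu, if_neg hP, mul_zero, tsum_zero]
  have h3 : c₃ * (if P₃ then ∑' k, t k d₃ else 0) = ∑' k, v k := by
    by_cases hP : P₃
    · simp only [hv, if_pos hP]; rw [tsum_mul_left]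
    · simp only [hv, if_neg hP, mul_zero, tsum_zero]
  rw [h2, h3]
  have hs1 : Summable fun k ↦ t (k + 1) n := (summable_nat_add_iff 1).mpr (hs n)
  have hs2 : Summable fun k ↦ t (k + 2) n := (summable_nat_add_iff 2).mpr (hs n)
  have hsu1 : Summable fun k ↦ u (k + 1) := (summable_nat_add_iff 1).mpr hsu
  rw [(hs n).tsum_eq_zero_add, hs1.tsum_eq_zero_add, hsu.tsum_eq_zero_add]
  have hcomb : ∑' k, t (k + 1 + 1) n - ∑' k, u (k + 1) + ∑' k, v k = ∑' k, (t (k + 2) n - u (k + 1) + v k) := by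
    rw [← hs2.tsum_sub hsu1, ← (hs2.sub hsu1).tsum_add hsv]
  have hrearr : t 0 n + (t (0 + 1) n + ∑' k, t (k + 1 + 1) n) - (u 0 + ∑' k, u (k + 1)) + ∑' k, v k =
      (t 0 n + (t 1 n - u 0)) + (∑' k, t (k + 1 + 1) n - ∑' k, u (k + 1) + ∑' k, v k) := by ring
  rw [hrearr, hcomb]
  refine (IsUltrametricDist.norm_add_le_max _ _).trans (max_le ((IsUltrametricDist.norm_add_le_max _ _).trans
    (max_le h0 h1)) ?_)
  exact IsUltrametricDist.norm_tsum_le_of_forall_le_of_nonneg zero_le_one fun k ↦ hk k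


/-- At `d = 0` the term `x_k (C(pᵏ, 0) − 1)` vanishes. [folklore] -/
theorem sprungTerm_zero (x : ℕ → ℚ_[p]) (k : ℕ) :
    x k * (((p ^ k).choose 0 : ℚ_[p]) - if (0 : ℕ) = 0 then 1 else 0) = 0 := by
  simp

/-- **`‖x_k (C(pᵏ, d) − [d = 0])‖ ≤ d · (√p)⁻ᵏ`** under the growth bound `‖x_k‖ ≤ (√p)ᵏ`
(`‖C(pᵏ, d)‖ ≤ d p⁻ᵏ`). [folklore] -/
theorem norm_sprungTerm_le {x : ℕ → ℚ_[p]} (hxb : ∀ k, ‖x k‖ ≤ Real.sqrt p ^ k) (k d : ℕ) :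
    ‖x k * (((p ^ k).choose d : ℚ_[p]) - if d = 0 then 1 else 0)‖ ≤ d * ((Real.sqrt p)⁻¹) ^ k := by
  rcases Nat.eq_zero_or_pos d with rfl | hd
  · rw [sprungTerm_zero]; simp
  rw [if_neg hd.ne', sub_zero, norm_mul]
  have h := norm_choose_prime_pow_le p k hd.ne'
  calc ‖x k‖ * ‖((p ^ k).choose d : ℚ_[p])‖ ≤ Real.sqrt p ^ k * (d * ((p : ℝ)⁻¹) ^ k) :=
        mul_le_mul (hxb k) h (norm_nonneg _) (by positivity)
    _ = d * (Real.sqrt p ^ k * ((p : ℝ)⁻¹) ^ k) := by ring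
    _ = d * ((Real.sqrt p)⁻¹) ^ k := by rw [sqrt_pow_mul_inv_pow]

/-- The terms `x_k (C(pᵏ, d) − [d = 0])` are summable in `k` (geometric majorant, ratio `(√p)⁻¹`). [folklore] -/
theorem summable_sprungTerm {x : ℕ → ℚ_[p]} (hxb : ∀ k, ‖x k‖ ≤ Real.sqrt p ^ k) (d : ℕ) :
    Summable fun k : ℕ ↦ x k * (((p ^ k).choose d : ℚ_[p]) - if d = 0 then 1 else 0) := by
  obtain ⟨hr1, hr0⟩ := sqrt_inv_lt_one (p := p)
  refine Summable.of_norm_bounded (g := fun k : ℕ ↦ (d : ℝ) * ((Real.sqrt p)⁻¹) ^ k) ?_ (norm_sprungTerm_le hxb · d)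
  exact (summable_geometric_of_lt_one hr0 hr1).mul_left _

/-- The coefficients of the Sprung logarithm `log_{F_ss} = PowerSeries.mk fun d ↦ ∑' k, x_k (C(pᵏ,d) − [d = 0])`.
[cite: Sprung2012, proof of Thm. 2.2 (p. 1487)] -/
theorem coeff_sprungLog (x : ℕ → ℚ_[p]) (d : ℕ) :
    coeff d (PowerSeries.mk fun d ↦ ∑' k : ℕ, x k * (((p ^ k).choose d : ℚ_[p]) - if d = 0 then 1 else 0)) =
      ∑' k : ℕ, x k * (((p ^ k).choose d : ℚ_[p]) - if d = 0 then 1 else 0) := by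
  rw [coeff_mk]

/-- `log_{F_ss}(0) = 0`. [folklore] -/
theorem constantCoeff_sprungLog (x : ℕ → ℚ_[p]) :
    constantCoeff (PowerSeries.mk fun d ↦ ∑' k : ℕ, x k * (((p ^ k).choose d : ℚ_[p]) - if d = 0 then 1 else 0)) = 0 := by
  rw [← coeff_zero_eq_constantCoeff, coeff_sprungLog]
  simp

/-- **`‖[Xᵈ] log_{F_ss}‖ ≤ d`** (logarithmic growth of the coefficients; Kobayashi's `P`, §8.1). [cite: Kobayashi2003, §8.1–8.2] -/
theorem norm_coeff_sprungLog_le {x : ℕ → ℚ_[p]} (hxb : ∀ k, ‖x k‖ ≤ Real.sqrt p ^ k) (d : ℕ) :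
    ‖coeff d (PowerSeries.mk fun d ↦ ∑' k : ℕ, x k * (((p ^ k).choose d : ℚ_[p]) - if d = 0 then 1 else 0))‖ ≤ d := by
  obtain ⟨hr1, hr0⟩ := sqrt_inv_lt_one (p := p)
  rw [coeff_sprungLog]
  refine IsUltrametricDist.norm_tsum_le_of_forall_le_of_nonneg (Nat.cast_nonneg d) fun k ↦ ?_
  refine (norm_sprungTerm_le hxb k d).trans ?_
  calc (d : ℝ) * ((Real.sqrt p)⁻¹) ^ k ≤ d * 1 :=
        mul_le_mul_of_nonneg_left (pow_le_one₀ hr0 hr1.le) (Nat.cast_nonneg d)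
    _ = d := mul_one _

/-- **`‖[X¹] log_{F_ss}‖ = 1`**: `[X¹] log = ∑ₖ x_k pᵏ`, whose `k = 0` term is `x₀ = 1` and whose tail has norm `< 1`.
[folklore] -/
theorem norm_coeff_one_sprungLog {x : ℕ → ℚ_[p]} (hx0 : x 0 = 1) (hxb : ∀ k, ‖x k‖ ≤ Real.sqrt p ^ k) :
    ‖coeff 1 (PowerSeries.mk fun d ↦ ∑' k : ℕ, x k * (((p ^ k).choose d : ℚ_[p]) - if d = 0 then 1 else 0))‖ = 1 := by
  obtain ⟨hr1, hr0⟩ := sqrt_inv_lt_one (p := p)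
  rw [coeff_sprungLog]
  have hs := summable_sprungTerm hxb 1
  rw [hs.tsum_eq_zero_add]
  have h0 : x 0 * (((p ^ 0).choose 1 : ℚ_[p]) - if (1 : ℕ) = 0 then 1 else 0) = 1 := by simp [hx0]
  have htail : ‖∑' k : ℕ, x (k + 1) * (((p ^ (k + 1)).choose 1 : ℚ_[p]) - if (1 : ℕ) = 0 then 1 else 0)‖ < 1 := by
    refine (IsUltrametricDist.norm_tsum_le_of_forall_le_of_nonneg hr0 fun k ↦ ?_).trans_lt hr1
    refine (norm_sprungTerm_le hxb (k + 1) 1).trans ?_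
    rw [Nat.cast_one, one_mul, pow_succ]
    exact mul_le_of_le_one_left hr0 (pow_le_one₀ hr0 hr1.le)
  rw [h0, IsUltrametricDist.norm_add_eq_max_of_norm_ne_norm, norm_one, max_eq_left htail.le]
  rw [norm_one]; exact (ne_of_lt htail).symm

/-- **The combined term is integral.** With `t k d = x_k (C(pᵏ,d) − [d=0])`:
`‖t (k+2) n − (a/p)[p ∣ n] t (k+1) (n/p) + (1/p)[p² ∣ n] t k (n/p²)‖ ≤ 1`, because by the recursion
`p x_{k+2} = a x_{k+1} − x_k` it equals `(a/p)x_{k+1}[Xⁿ]((1+X)^{p^{k+2}} − (1+Xᵖ)^{p^{k+1}}) − (1/p)x_k[Xⁿ]((1+X)^{p^{k+2}} −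
(1+X^{p²})^{pᵏ})`, and the two differences are `≡ 0` modulo `p^{k+2}`, `p^{k+1}`. [cite: Kobayashi2003, §8.2 and Thm. 8.3 iii)] -/
theorem norm_sprung_combined_le_one {a : ℚ_[p]} (ha : ‖a‖ ≤ (p : ℝ)⁻¹) {x : ℕ → ℚ_[p]}
    (hrec : ∀ k, (p : ℚ_[p]) * x (k + 2) = a * x (k + 1) - x k) (hxb : ∀ k, ‖x k‖ ≤ Real.sqrt p ^ k)
    (k n : ℕ) :
    ‖x (k + 2) * (((p ^ (k + 2)).choose n : ℚ_[p]) - if n = 0 then 1 else 0) -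
        a / p * (if p ∣ n then x (k + 1) * (((p ^ (k + 1)).choose (n / p) : ℚ_[p]) - if n / p = 0 then 1 else 0) else 0) +
        1 / (p : ℚ_[p]) * (if p ^ 2 ∣ n then x k * (((p ^ k).choose (n / p ^ 2) : ℚ_[p]) -
          if n / p ^ 2 = 0 then 1 else 0) else 0)‖ ≤ 1 := by
  obtain ⟨hs1, hss⟩ := one_le_sqrt_p (p := p)
  have hp0 : (0 : ℝ) < p := by exact_mod_cast hp.out.pos
  have hpQ : (p : ℚ_[p]) ≠ 0 := Nat.cast_ne_zero.mpr hp.out.ne_zero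
  have hnp : ‖(p : ℚ_[p])‖ = (p : ℝ)⁻¹ := Padic.norm_p
  set D1 := (1 + X : ℚ_[p]⟦X⟧) ^ p ^ (k + 1 + 1) - expand p (prime_ne_zero p) ((1 + X : ℚ_[p]⟦X⟧) ^ p ^ (k + 1))
    with hD1
  set D2 := (1 + X : ℚ_[p]⟦X⟧) ^ p ^ (k + 2) - expand (p ^ 2) (prime_sq_ne_zero p) ((1 + X : ℚ_[p]⟦X⟧) ^ p ^ k)
    with hD2
  have hx2 : x (k + 2) = (a * x (k + 1) - x k) / p := (eq_div_iff hpQ).mpr (by rw [mul_comm]; exact hrec k)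
  have key : x (k + 2) * (((p ^ (k + 2)).choose n : ℚ_[p]) - if n = 0 then 1 else 0) -
        a / p * (if p ∣ n then x (k + 1) * (((p ^ (k + 1)).choose (n / p) : ℚ_[p]) - if n / p = 0 then 1 else 0) else 0) +
        1 / (p : ℚ_[p]) * (if p ^ 2 ∣ n then x k * (((p ^ k).choose (n / p ^ 2) : ℚ_[p]) -
          if n / p ^ 2 = 0 then 1 else 0) else 0) =
      a / p * x (k + 1) * coeff n D1 - 1 / p * x k * coeff n D2 := by
    rw [hD1, hD2, ← choose_sub_choose_div_eq_coeff, ← choose_sub_choose_div_sq_eq_coeff, hx2,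
      show k + 1 + 1 = k + 2 from rfl]
    split_ifs <;> ring
  rw [key]
  have hb1 := norm_coeff_pow_sub_expand_p_pow_le (p := p) (k + 1) n
  have hb2 := norm_coeff_pow_sub_expand_sq_pow_le (p := p) k n
  rw [← hD1] at hb1
  rw [← hD2] at hb2
  have hsp : Real.sqrt p ≤ p := by nlinarith
  have h1 : ‖a / p * x (k + 1) * coeff n D1‖ ≤ 1 := by
    rw [norm_mul, norm_mul, norm_div, hnp]
    calc ‖a‖ / (p : ℝ)⁻¹ * ‖x (k + 1)‖ * ‖coeff n D1‖
        ≤ ((p : ℝ)⁻¹ / (p : ℝ)⁻¹) * Real.sqrt p ^ (k + 1) * ((p : ℝ)⁻¹ ^ (k + 1 + 1)) := by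
          gcongr
          exact hxb (k + 1)
      _ = Real.sqrt p ^ (k + 1) * ((p : ℝ)⁻¹ ^ (k + 2)) := by rw [div_self (by positivity), one_mul]
      _ ≤ (p : ℝ) ^ (k + 1) * ((p : ℝ)⁻¹ ^ (k + 2)) := by gcongr
      _ = (p : ℝ)⁻¹ := by
          rw [pow_succ ((p : ℝ)⁻¹) (k + 1), ← mul_assoc, ← mul_pow, mul_inv_cancel₀ (by positivity), one_pow, one_mul]
      _ ≤ 1 := inv_le_one_of_one_le₀ (by exact_mod_cast hp.out.one_lt.le)
  have h2 : ‖1 / p * x k * coeff n D2‖ ≤ 1 := by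
    rw [norm_mul, norm_mul, norm_div, norm_one, hnp, one_div, inv_inv]
    calc (p : ℝ) * ‖x k‖ * ‖coeff n D2‖ ≤ p * Real.sqrt p ^ k * ((p : ℝ)⁻¹ ^ (k + 1)) := by
          gcongr
          exact hxb k
      _ ≤ p * (p : ℝ) ^ k * ((p : ℝ)⁻¹ ^ (k + 1)) := by gcongr
      _ = 1 := by rw [← pow_succ', ← mul_pow, mul_inv_cancel₀ (by positivity), one_pow]
  exact (Literature.NumberTheory.EllipticCurves.padic_norm_sub_le_max _ _).trans (max_le h1 h2)

/-- **The Sprung logarithm is of Honda type `p − aT + T²`**: `hondaShift p a log_{F_ss} ∈ ℤ_p⟦X⟧`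
(Kobayashi Thm. 8.3 iii) for the Eisenstein polynomial `t² − a t + p`; Sprung 2012 p. 1487: "what we need is a formal group
whose logarithm is of Honda type `t² − a_p t + p`"). Hypotheses: `‖a‖ ≤ p⁻¹` (supersingular) and `x` the Sprung sequence.
[cite: Sprung2012, proof of Thm. 2.2 (p. 1487)] -/
theorem norm_coeff_hondaShift_sprungLog_le_one {a : ℚ_[p]} (ha : ‖a‖ ≤ (p : ℝ)⁻¹) {x : ℕ → ℚ_[p]} (hx0 : x 0 = 1)
    (hx1 : (p : ℚ_[p]) * x 1 = a) (hrec : ∀ k, (p : ℚ_[p]) * x (k + 2) = a * x (k + 1) - x k) (n : ℕ) :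
    ‖coeff n (hondaShift p a
      (PowerSeries.mk fun d ↦ ∑' k : ℕ, x k * (((p ^ k).choose d : ℚ_[p]) - if d = 0 then 1 else 0)))‖ ≤ 1 := by
  have hxb := norm_sprungSeq_le ha hx0 hx1 hrec
  have hp0 : (0 : ℝ) < p := by exact_mod_cast hp.out.pos
  have hpQ : (p : ℚ_[p]) ≠ 0 := Nat.cast_ne_zero.mpr hp.out.ne_zero
  have hnp : ‖(p : ℚ_[p])‖ = (p : ℝ)⁻¹ := Padic.norm_p
  rw [coeff_hondaShift]
  simp only [coeff_sprungLog]
  refine norm_three_tsum_comb_le_one (t := fun k d ↦ x k * (((p ^ k).choose d : ℚ_[p]) - if d = 0 then 1 else 0))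
    (summable_sprungTerm hxb) (a / p) (1 / (p : ℚ_[p])) n (n / p) (n / p ^ 2) ?_ ?_ ?_
  · -- `t 0 n = C(1, n) − [n = 0]` is `[n = 1]`
    simp only [hx0, pow_zero, one_mul]
    rcases n with _ | _ | n
    · simp
    · simp
    · rw [if_neg (by omega), sub_zero, Nat.choose_eq_zero_of_lt (by omega)]; simp
  · -- `t 1 n − (a/p)[p∣n] t 0 (n/p) = (a/p)·[Xⁿ]((1+X)^p − (1+Xᵖ))`
    have e1 : x 1 = a / p := (eq_div_iff hpQ).mpr (by rw [mul_comm]; exact hx1)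
    have hD := norm_coeff_pow_sub_expand_p_pow_le (p := p) 0 n
    have hid := choose_sub_choose_div_eq_coeff (p := p) 0 n
    simp only [zero_add, pow_one, pow_zero] at hD hid
    have key : x 1 * (((p ^ 1).choose n : ℚ_[p]) - if n = 0 then 1 else 0) -
        a / p * (if p ∣ n then x 0 * (((p ^ 0).choose (n / p) : ℚ_[p]) - if n / p = 0 then 1 else 0) else 0) =
        a / p * coeff n ((1 + X : ℚ_[p]⟦X⟧) ^ p - expand p (prime_ne_zero p) (1 + X : ℚ_[p]⟦X⟧)) := by
      rw [← hid, e1, hx0, pow_one, pow_zero]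
      split_ifs <;> ring
    rw [key, norm_mul, norm_div, hnp]
    calc ‖a‖ / (p : ℝ)⁻¹ * ‖coeff n ((1 + X : ℚ_[p]⟦X⟧) ^ p - expand p (prime_ne_zero p) (1 + X))‖
        ≤ (p : ℝ)⁻¹ / (p : ℝ)⁻¹ * (p : ℝ)⁻¹ := by gcongr
      _ = (p : ℝ)⁻¹ := by rw [div_self (by positivity), one_mul]
      _ ≤ 1 := inv_le_one_of_one_le₀ (by exact_mod_cast hp.out.one_lt.le)
  · intro k
    exact norm_sprung_combined_le_one ha hrec hxb k n

end SprungHonda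
end Summit.BirchSwinnertonDyer.BirchSwinnertonDyer.Theorems
end
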